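import Summits.HodgeConjecture.HodgeConjecture.Theorems.LinearSystemTorelliMiddleDivisorSupportFourfoldStubFiniteMonodromyOfTypeStability
import Summits.HodgeConjecture.HodgeConjecture.Theses.LinearSystemTorelli
import HarnessLib

/-!
# Route `LinearSystemTorelli` — crux `MiddleDivisorSupportFourfold` (stmt-HodgeConjecture-2409) is
# downstream of `PeriodDeficiency.FiniteMonodromyAlgebraicOfQbar` (stmt-15380): items-only residue

Helper file for the crux item stmt-HodgeConjecture-2409 (`--supports`; it closes nothing), line
`IdeatorFiveSketch` (idea `weakly-nonfactor-descent`), lead c11.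

The line's registered residue (lead c10,
`linearSystemTorelli_middleDivisorSupportFourfold_of_lineResidue_of_typeStability`) is
crux ⟸ T ∧ `PeriodDeficiency.HodgeConjectureQbar` modulo TWO classical named-fact debts (Riemann's
existence theorem over `ℂ` in covering form; Deligne's partie fixe = stmt-16363), the debts entering
through the line's own PROVED transfer stub B (dominant `ℚ̄`-envelope of a finite-monodromy class).
Route `PeriodDeficiency` carries Voisin's finite-monodromy step as a CRUX ITEM in its own right,
`FiniteMonodromyAlgebraicOfQbar` (stmt-HodgeConjecture-15380 = the named fact
`voisin2007_algebraic_of_finite_monodromyOrbit_of_qbar`, Voisin 2007 §3 / Charles–Schnell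
Thm. 11.3.19: a rational `(p,p)` class with FINITE monodromy orbit on a fibre of a smooth projective
`ℚ̄`-family is algebraic, granted the Hodge conjecture for `ℚ̄`-varieties), which packages those
debts (and Fulton's pull-back) inside ONE existing item.  Since the A-side of the line is
unconditional (`stub_finiteMonodromyAtGenericSpread_of_typeStabilityAtQbarGeneric`, p127337: type
stability T ⟹ finite monodromy at the `ℚ̄`-generic spread point), the crux has an ITEMS-ONLY
residue with no named fact at all:

  T → PeriodDeficiency.FiniteMonodromyAlgebraicOfQbar (stmt-15380) →
    PeriodDeficiency.HodgeConjectureQbar (stmt-11596) → MiddleDivisorSupportFourfold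

(`linearSystemTorelli_middleDivisorSupportFourfold_of_typeStability_of_finiteMonodromyAlgebraicOfQbar`,
registered sub-goal).  Proof: fix `σ`; spread `X ≅ 𝒳_s` with `s` over the generic point (PROVED);
T gives a finite orbit for `(e⁻¹)^* c`; stmt-15380 with HC/`ℚ̄` makes it ALGEBRAIC on `𝒳_s`;
algebraic classes transport back along `e` (`mem_algebraicClasses_map_iff_of_iso`) and `N² ⊆ N¹`
(`supportedClasses_mono`).  The all-`p` form for the support item `MiddleDivisorSupport`
(stmt-1081) is `linearSystemTorelli_middleDivisorSupport_of_typeStability_of_finiteMonodromyAlgebraicOfQbar`.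
-/

-- every declaration of this problem lives in `Summit.HodgeConjecture.HodgeConjecture.…`
set_option linter.dupNamespace false

noncomputable section

namespace Summit.HodgeConjecture.HodgeConjecture.Theorems

open CategoryTheory AlgebraicGeometry
open _root_.Topology
open Summit.HodgeConjecture.HodgeConjecture.Theses
open Literature.AlgebraicGeometry Literature.AlgebraicGeometry.Motives
open Literature.AlgebraicGeometry.HodgeTheory
open Literature.AlgebraicTopology.SingularHomology

/-- **stmt-2409 ⟸ T ∧ stmt-15380 ∧ stmt-11596 (items only, no named fact)** — registered sub-goal
of the crux, arrow form.  Every rational `(2,2)`-class `c` on a smooth projective complex fourfold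
`X` is supported on a divisor, granted (i) T: type stability of `(2,2)` loop-continuations at
`ℚ̄`-generic points of smooth projective `ℚ̄`-families of fourfolds (OPEN; the line's transcendence
kernel), (ii) `PeriodDeficiency.FiniteMonodromyAlgebraicOfQbar` (stmt-15380: Voisin's
finite-monodromy step, known mathematics, formally apex) and (iii)
`PeriodDeficiency.HodgeConjectureQbar` (stmt-11596).  Proof: fix `σ : ℚ̄ →+* ℂ`; spread `X` over
`ℚ̄` and get a finite monodromy orbit for `(e⁻¹)^* c` at the `ℚ̄`-generic point from T
(`stub_finiteMonodromyAtGenericSpread_of_typeStabilityAtQbarGeneric`, unconditional); stmt-15380 fed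
with HC/`ℚ̄` makes `(e⁻¹)^* c` algebraic on `𝒳_s`; transport along `e : X ≅ 𝒳_s`
(`mem_algebraicClasses_map_iff_of_iso`) and weaken algebraic to divisor-supported (`N² ⊆ N¹`,
`supportedClasses_mono`). [cite: Voisin2007HodgeLoci, §3, proof of Prop. 0.7]
[cite: CharlesSchnell2014Notes, Thm. 11.3.19] [cite: GrothendieckTopology1969, §1] -/
theorem linearSystemTorelli_middleDivisorSupportFourfold_of_typeStability_of_finiteMonodromyAlgebraicOfQbar :
    (∀ (σ : AlgebraicClosure ℚ →+* ℂ) ⦃𝒳₀ S₀ : SchemeOver (AlgebraicClosure ℚ)⦄ (f₀ : 𝒳₀ ⟶ S₀),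
      IsQuasiProjectiveOver 𝒳₀ → IsQuasiProjectiveOver S₀ → IrreducibleSpace S₀.left →
      AlgebraicGeometry.Smooth S₀.hom → IsSmoothProjectiveFamily ((baseChangeHom σ).map f₀) 4 →
      ∀ (s : ComplexPoints ((baseChangeHom σ).obj S₀)),
        closure {(baseChangeHomFst σ S₀).base s.pt} = (Set.univ : Set S₀.left) →
        ∀ (α : complexBetti (fiberOver ((baseChangeHom σ).map f₀) s) 4),
          IsRationalClass α → IsOfHodgeType 4 (fiberOver ((baseChangeHom σ).map f₀) s) 4 2 2 α →
          ∀ (γ : Path s s) (β : complexBetti (fiberOver ((baseChangeHom σ).map f₀) s) 4),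
            IsContinuationAlong γ α β →
              IsOfHodgeType 4 (fiberOver ((baseChangeHom σ).map f₀) s) 4 2 2 β) →
    Summit.HodgeConjecture.HodgeConjecture.Theses.PeriodDeficiency.FiniteMonodromyAlgebraicOfQbar →
    Summit.HodgeConjecture.HodgeConjecture.Theses.PeriodDeficiency.HodgeConjectureQbar →
    Summit.HodgeConjecture.HodgeConjecture.Theses.LinearSystemTorelli.MiddleDivisorSupportFourfold := by
  intro hT hV hQ X hX c hc hh
  obtain ⟨σ⟩ := exists_ringHom_algebraicClosure_rat_complex
  obtain ⟨𝒳₀, S₀, f₀, s, e, h𝒳₀, hS₀, hirr, hsm, hf, -, hfin⟩ :=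
    stub_finiteMonodromyAtGenericSpread_of_typeStabilityAtQbarGeneric hT σ hX c hc hh
  -- Voisin's finite-monodromy step (stmt-15380) at `p = 2`, fed with HC/`ℚ̄`
  have halg : complexBetti.map e.inv (2 * 2) c ∈
      algebraicClasses (fiberOver ((baseChangeHom σ).map f₀) s) 2 :=
    hV σ f₀ 4 2 h𝒳₀ hS₀ hirr hsm hf s (complexBetti.map e.inv 4 c) (hc.map _) (hh.map_of_iso e.symm)
      hfin (fun _ _ hX₀ q c' hc' hh' ↦ (hQ σ hX₀).2 q c' hc' hh')
  -- back along `e : X ≅ 𝒳_s`, then `N² ⊆ N¹`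
  have halgX : c ∈ algebraicClasses X 2 := (mem_algebraicClasses_map_iff_of_iso e.symm).1 halg
  exact supportedClasses_mono X 4 (show 1 ≤ 2 by norm_num) halgX

/-- **stmt-1081 ⟸ T(2p,p) ∧ stmt-15380 ∧ stmt-11596 (items only, all even dimensions).** Every
rational `(p,p)` class in the middle degree of a smooth projective complex `2p`-fold (`p ≥ 1`) is
supported on a divisor, granted type stability T(2p,p) at `ℚ̄`-generic points for all `p ≥ 1`,
`PeriodDeficiency.FiniteMonodromyAlgebraicOfQbar` (stmt-15380) and `PeriodDeficiency.HodgeConjectureQbar`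
(stmt-11596): spread (`spreadingOut_smoothProjective_qbarFamily_holds`, PROVED), finite orbit from T
(`linearSystemTorelli_finite_setOf_isContinuationAlong_of_forall_isOfHodgeType`, unconditional),
stmt-15380 + HC/`ℚ̄`, transport along the spreading isomorphism, `Nᵖ ⊆ N¹`.
[cite: Voisin2007HodgeLoci, §3, proof of Prop. 0.7] [cite: CharlesSchnell2014Notes, Thm. 11.3.19]
[cite: GrothendieckTopology1969, §1] -/
theorem linearSystemTorelli_middleDivisorSupport_of_typeStability_of_finiteMonodromyAlgebraicOfQbar :
    (∀ (p : ℕ), 1 ≤ p → ∀ (σ : AlgebraicClosure ℚ →+* ℂ) ⦃𝒳₀ S₀ : SchemeOver (AlgebraicClosure ℚ)⦄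
      (f₀ : 𝒳₀ ⟶ S₀), IsQuasiProjectiveOver 𝒳₀ → IsQuasiProjectiveOver S₀ → IrreducibleSpace S₀.left →
      AlgebraicGeometry.Smooth S₀.hom → IsSmoothProjectiveFamily ((baseChangeHom σ).map f₀) (2 * p) →
      ∀ (s : ComplexPoints ((baseChangeHom σ).obj S₀)),
        closure {(baseChangeHomFst σ S₀).base s.pt} = (Set.univ : Set S₀.left) →
        ∀ (α : complexBetti (fiberOver ((baseChangeHom σ).map f₀) s) (2 * p)),
          IsRationalClass α →
          IsOfHodgeType (2 * p) (fiberOver ((baseChangeHom σ).map f₀) s) (2 * p) p p α →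
          ∀ (γ : Path s s) (β : complexBetti (fiberOver ((baseChangeHom σ).map f₀) s) (2 * p)),
            IsContinuationAlong γ α β →
              IsOfHodgeType (2 * p) (fiberOver ((baseChangeHom σ).map f₀) s) (2 * p) p p β) →
    Summit.HodgeConjecture.HodgeConjecture.Theses.PeriodDeficiency.FiniteMonodromyAlgebraicOfQbar →
    Summit.HodgeConjecture.HodgeConjecture.Theses.PeriodDeficiency.HodgeConjectureQbar →
    Summit.HodgeConjecture.HodgeConjecture.Theses.LinearSystemTorelli.MiddleDivisorSupport := by
  intro hT hV hQ p X hp hX c hc hh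
  obtain ⟨σ⟩ := exists_ringHom_algebraicClosure_rat_complex
  obtain ⟨𝒳₀, S₀, f₀, s, h𝒳₀, hS₀, hirr, hsm, hf, hgen, ⟨e⟩⟩ :=
    spreadingOut_smoothProjective_qbarFamily_holds σ hX
  have hfin := linearSystemTorelli_finite_setOf_isContinuationAlong_of_forall_isOfHodgeType σ f₀ (2 * p)
    p hf h𝒳₀ hS₀ hirr hsm s (complexBetti.map e.inv (2 * p) c) (hc.map _)
    (hT p hp σ f₀ h𝒳₀ hS₀ hirr hsm hf s hgen (complexBetti.map e.inv (2 * p) c) (hc.map _)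
      (hh.map_of_iso e.symm))
  have halg : complexBetti.map e.inv (2 * p) c ∈
      algebraicClasses (fiberOver ((baseChangeHom σ).map f₀) s) p :=
    hV σ f₀ (2 * p) p h𝒳₀ hS₀ hirr hsm hf s (complexBetti.map e.inv (2 * p) c) (hc.map _)
      (hh.map_of_iso e.symm) hfin (fun _ _ hX₀ q c' hc' hh' ↦ (hQ σ hX₀).2 q c' hc' hh')
  have halgX : c ∈ algebraicClasses X p := (mem_algebraicClasses_map_iff_of_iso e.symm).1 halg
  exact supportedClasses_mono X (2 * p) hp halgX

end Summit.HodgeConjecture.HodgeConjecture.Theorems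

end
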